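import Mathlib

/-!
# The ORDER FILTER for the Marica–Schönheim pencil: triangular annihilators from an admissible order

Helper file for crux `stmt-CriticalPhenomena-4575` (`NoHeavyLowerTail`, route `PercNearOneGluingNoHeavy`),
new-inequality factory seat `prim-ineq-gen-3` (gen 25).  Everything here is PROVED; no definitions.

Pencil rows of a finite family `𝒜` of finite sets: `C ↦ (E ↦ [E ⊆ C] + t [E ∩ C = ∅])`.  Rank the members by
`r : Finset α → ℕ` ADMISSIBLY: `r B ≤ r C, B ≠ C ⟹ B ⊄ C` (e.g. `r C = N - #C`: bigger sets first).  Only the columns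
`B \ C` with `r B ≤ r C` are used (the "ordered half" of `𝒜 \\ 𝒜`, which contains `∅ = B \ B`).

* `dep_eq_zero_of_cotraceLocal` — **front peeling.**  For `A ∈ 𝒜` let `𝒲_A = {A \ C : C ∈ 𝒜, r A ≤ r C}` (the co-traces on
  `A` of the members not before `A`; contains `∅`) and let `L_A(t)` be the matrix `[W ∩ X = ∅] + t [W ⊆ X]` on `𝒲_A × 𝒲_A`.
  If every `L_A(t)` is injective, every dependency `c` of the pencil rows on the ordered half vanishes.
  [The member of least rank with `c_A ≠ 0`: the column `A \ B` (`r A ≤ r B`) reads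
  `∑_{X ∈ 𝒲_A} L_A[A \ B, X] · w(X) = 0` with `w(X) = ∑_{C : A \ C = X} c_C`, and `w(∅) = c_A` by admissibility.]
* `dep_eq_zero_of_traceLocal` — **back peeling**, the mirror statement with the trace families
  `𝒱_A = {B \ A : B ∈ 𝒜, r A ≤ r B}` on the complement of `A` and the matrices `[V ⊆ X] + t [V ∩ X = ∅]`
  (here the ranking satisfies `r C ≤ r B, B ≠ C ⟹ B ⊄ C`, i.e. no member contains a member of larger rank, and the
  members are peeled in increasing rank = from the small sets upwards).
* `linearIndependent_pencil_of_cotraceLocal`, `linearIndependent_pencil_of_traceLocal` — hence the pencil rows over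
  `𝒜 \\ 𝒜` are linearly independent over any field at any `t` at which all local matrices of SOME admissible ranking are
  injective; `local_injective_of_det_ne_zero` turns this into the non-vanishing of the local determinants
  `Δ_A(t) = det L_A(t)`.  Consequently every eigenvalue `t` of the pencil (any field) is a common root of the products
  `∏_A Δ_A(t)` taken over ALL admissible rankings and both peeling directions — the ORDER FILTER.  Numerically
  (memo `run/shared/lean/prim/prim-ineq-gen-3/FINDINGS-gen25.md`) the filter leaves only `t = ±1` for every family tested
  (exhaustive on 4 points, the Fano plane, `PG(2,3)`, Paley designs, circulants, thousands of random families), i.e. it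
  certifies the characteristic-0 pencil conjecture (C0) family by family; the least-traces theorem of
  `…OrderedDifferencesLocal` is the special case in which `L_A(t)` is conjugate to `t + N` with `N³ = N`.
(prim-ineq-gen-3 gen 25, 2026-08-24.)
-/

namespace Summit.CriticalPhenomena.PercolationContinuityZ3.Theorems

namespace OrderedDifferences

open Finset
open scoped FinsetFamily

variable {α : Type*} [DecidableEq α] {K : Type*} [Field K]

/-- **Front peeling (co-trace local matrices).**  Let `r` rank the members of `𝒜` admissibly (`r B ≤ r C`, `B ≠ C`
`⟹ B ⊄ C`), let the column set `𝒞` contain `B \ C` whenever `r B ≤ r C`, and let `c` be a dependency of the pencil rows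
at `t` on `𝒞`.  If for every `A ∈ 𝒜` the local matrix `[W ∩ X = ∅] + t [W ⊆ X]` on the co-trace family
`𝒲_A = {A \ C : C ∈ 𝒜, r A ≤ r C}` is injective, then `c = 0` on `𝒜`. -/
theorem dep_eq_zero_of_cotraceLocal (𝒜 : Finset (Finset α)) (r : Finset α → ℕ)
    (hr : ∀ B ∈ 𝒜, ∀ C ∈ 𝒜, B ≠ C → r B ≤ r C → ¬ B ⊆ C)
    (𝒞 : Finset (Finset α)) (h𝒞 : ∀ B ∈ 𝒜, ∀ C ∈ 𝒜, r B ≤ r C → B \ C ∈ 𝒞)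
    (t : K) (c : Finset α → K)
    (hdep : ∀ E ∈ 𝒞, ∑ C ∈ 𝒜, c C * ((if E ⊆ C then (1 : K) else 0) +
      t * (if Disjoint E C then (1 : K) else 0)) = 0)
    (hloc : ∀ A ∈ 𝒜, ∀ w : Finset α → K,
      (∀ W ∈ (𝒜.filter (fun C => r A ≤ r C)).image (fun C => A \ C),
        ∑ X ∈ (𝒜.filter (fun C => r A ≤ r C)).image (fun C => A \ C),
          ((if Disjoint W X then (1 : K) else 0) + t * (if W ⊆ X then (1 : K) else 0)) * w X = 0) →
      ∀ X ∈ (𝒜.filter (fun C => r A ≤ r C)).image (fun C => A \ C), w X = 0) :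
    ∀ A ∈ 𝒜, c A = 0 := by
  classical
  suffices h : ∀ n : ℕ, ∀ A ∈ 𝒜, r A < n → c A = 0 from
    fun A hA => h (r A + 1) A hA (Nat.lt_succ_self _)
  intro n
  induction n with
  | zero => intro A _ h; exact absurd h (Nat.not_lt_zero _)
  | succ n ih =>
    intro A hA hAn
    rcases Nat.lt_succ_iff_lt_or_eq.mp hAn with hlt | heq
    · exact ih A hA hlt
    · set 𝒜' : Finset (Finset α) := 𝒜.filter (fun C => r A ≤ r C) with h𝒜'
      set 𝒲 : Finset (Finset α) := 𝒜'.image (fun C => A \ C) with h𝒲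
      let w : Finset α → K := fun X => ∑ C ∈ 𝒜'.filter (fun C => A \ C = X), c C
      -- the local equations hold for `w`
      have hw : ∀ W ∈ 𝒲, ∑ X ∈ 𝒲, ((if Disjoint W X then (1 : K) else 0) +
          t * (if W ⊆ X then (1 : K) else 0)) * w X = 0 := by
        intro W hW
        obtain ⟨B, hB, hBW⟩ := mem_image.mp hW
        have hB𝒜 : B ∈ 𝒜 := (mem_filter.mp hB).1
        have hrB : r A ≤ r B := (mem_filter.mp hB).2
        have h0 := hdep (A \ B) (h𝒞 A hA B hB𝒜 hrB)
        rw [← sum_filter_add_sum_filter_not 𝒜 (fun C => r A ≤ r C)] at h0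
        have hrest : ∑ C ∈ 𝒜.filter (fun C => ¬ r A ≤ r C), c C * ((if A \ B ⊆ C then (1 : K) else 0) +
            t * (if Disjoint (A \ B) C then (1 : K) else 0)) = 0 := by
          refine sum_eq_zero fun C hC => ?_
          obtain ⟨hC𝒜, hrC⟩ := mem_filter.mp hC
          rw [ih C hC𝒜 (by omega), zero_mul]
        rw [hrest, add_zero] at h0
        -- regroup the sum over `𝒜'` by the fibres of `C ↦ A \ C`
        have hfib : ∑ X ∈ 𝒲, ((if Disjoint W X then (1 : K) else 0) +
            t * (if W ⊆ X then (1 : K) else 0)) * w X =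
            ∑ C ∈ 𝒜', c C * ((if A \ B ⊆ C then (1 : K) else 0) +
              t * (if Disjoint (A \ B) C then (1 : K) else 0)) := by
          have hmaps : ∀ C ∈ 𝒜', A \ C ∈ 𝒲 := fun C hC => mem_image_of_mem _ hC
          rw [← sum_fiberwise_of_maps_to hmaps]
          refine sum_congr rfl fun X _ => ?_
          rw [mul_sum]
          refine sum_congr rfl fun C hC => ?_
          obtain ⟨_, hCX⟩ := mem_filter.mp hC
          -- the two incidences coincide: `[A \ B ⊆ C] = [(A \ B) ∩ (A \ C) = ∅]`, `[(A \ B) ∩ C = ∅] = [A \ B ⊆ A \ C]`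
          have e1 : (A \ B ⊆ C) ↔ Disjoint W X := by
            rw [← hBW, ← hCX, disjoint_left]
            constructor
            · intro h x hx hx'
              exact (mem_sdiff.mp hx').2 (h hx)
            · intro h x hx
              by_contra hxC
              exact h hx (mem_sdiff.mpr ⟨(mem_sdiff.mp hx).1, hxC⟩)
          have e2 : Disjoint (A \ B) C ↔ W ⊆ X := by
            rw [← hBW, ← hCX, disjoint_left]
            constructor
            · intro h x hx
              exact mem_sdiff.mpr ⟨(mem_sdiff.mp hx).1, h hx⟩
            · intro h x hx hxC
              exact (mem_sdiff.mp (h hx)).2 hxC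
          rw [mul_comm]
          congr 2
          · exact if_congr e1.symm rfl rfl
          · congr 1
            exact if_congr e2.symm rfl rfl
        rw [hfib, h0]
      have hzero := hloc A hA w hw
      -- the fibre of `∅` is `{A}` by admissibility
      have hA' : A ∈ 𝒜' := mem_filter.mpr ⟨hA, le_rfl⟩
      have hempty : ∅ ∈ 𝒲 := mem_image.mpr ⟨A, hA', by simp⟩
      have h := hzero ∅ hempty
      have e : 𝒜'.filter (fun C => A \ C = ∅) = {A} := by
        ext C
        simp only [mem_filter, mem_singleton, sdiff_eq_empty_iff_subset]
        constructor
        · rintro ⟨hC, hAC⟩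
          obtain ⟨hC𝒜, hrC⟩ := mem_filter.mp hC
          by_contra hne
          exact hr A hA C hC𝒜 (Ne.symm hne) hrC hAC
        · rintro rfl
          exact ⟨hA', subset_rfl⟩
      change ∑ C ∈ 𝒜'.filter (fun C => A \ C = ∅), c C = 0 at h
      rwa [e, sum_singleton] at h

/-- **Back peeling (trace local matrices).**  Let `r` rank the members of `𝒜` so that `r C ≤ r B`, `B ≠ C ⟹ B ⊄ C`
(no member contains a member of larger rank; e.g. `r C = #C`), let `𝒞` contain `B \ C` whenever `r C ≤ r B`, and let
`c` be a dependency of the pencil rows at `t` on `𝒞`.  If for every `A ∈ 𝒜` the local matrix `[V ⊆ X] + t [V ∩ X = ∅]` on the trace family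
`𝒱_A = {B \ A : B ∈ 𝒜, r A ≤ r B}` (traces on the complement of `A` of the members not after `A`) is injective, then
`c = 0` on `𝒜`. -/
theorem dep_eq_zero_of_traceLocal (𝒜 : Finset (Finset α)) (r : Finset α → ℕ)
    (hr : ∀ B ∈ 𝒜, ∀ C ∈ 𝒜, B ≠ C → r C ≤ r B → ¬ B ⊆ C)
    (𝒞 : Finset (Finset α)) (h𝒞 : ∀ B ∈ 𝒜, ∀ C ∈ 𝒜, r C ≤ r B → B \ C ∈ 𝒞)
    (t : K) (c : Finset α → K)
    (hdep : ∀ E ∈ 𝒞, ∑ C ∈ 𝒜, c C * ((if E ⊆ C then (1 : K) else 0) +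
      t * (if Disjoint E C then (1 : K) else 0)) = 0)
    (hloc : ∀ A ∈ 𝒜, ∀ w : Finset α → K,
      (∀ V ∈ (𝒜.filter (fun B => r A ≤ r B)).image (fun B => B \ A),
        ∑ X ∈ (𝒜.filter (fun B => r A ≤ r B)).image (fun B => B \ A),
          ((if V ⊆ X then (1 : K) else 0) + t * (if Disjoint V X then (1 : K) else 0)) * w X = 0) →
      ∀ X ∈ (𝒜.filter (fun B => r A ≤ r B)).image (fun B => B \ A), w X = 0) :
    ∀ A ∈ 𝒜, c A = 0 := by
  classical
  suffices h : ∀ n : ℕ, ∀ A ∈ 𝒜, r A < n → c A = 0 from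
    fun A hA => h (r A + 1) A hA (Nat.lt_succ_self _)
  intro n
  induction n with
  | zero => intro A _ h; exact absurd h (Nat.not_lt_zero _)
  | succ n ih =>
    intro A hA hAn
    rcases Nat.lt_succ_iff_lt_or_eq.mp hAn with hlt | heq
    · exact ih A hA hlt
    · set 𝒜' : Finset (Finset α) := 𝒜.filter (fun B => r A ≤ r B) with h𝒜'
      set 𝒱 : Finset (Finset α) := 𝒜'.image (fun B => B \ A) with h𝒱
      let w : Finset α → K := fun X => ∑ C ∈ 𝒜'.filter (fun C => C \ A = X), c C
      have hw : ∀ V ∈ 𝒱, ∑ X ∈ 𝒱, ((if V ⊆ X then (1 : K) else 0) +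
          t * (if Disjoint V X then (1 : K) else 0)) * w X = 0 := by
        intro V hV
        obtain ⟨B, hB, hBV⟩ := mem_image.mp hV
        have hB𝒜 : B ∈ 𝒜 := (mem_filter.mp hB).1
        have hrB : r A ≤ r B := (mem_filter.mp hB).2
        have h0 := hdep (B \ A) (h𝒞 B hB𝒜 A hA hrB)
        rw [← sum_filter_add_sum_filter_not 𝒜 (fun C => r A ≤ r C)] at h0
        have hrest : ∑ C ∈ 𝒜.filter (fun C => ¬ r A ≤ r C), c C * ((if B \ A ⊆ C then (1 : K) else 0) +
            t * (if Disjoint (B \ A) C then (1 : K) else 0)) = 0 := by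
          refine sum_eq_zero fun C hC => ?_
          obtain ⟨hC𝒜, hrC⟩ := mem_filter.mp hC
          rw [ih C hC𝒜 (by omega), zero_mul]
        rw [hrest, add_zero] at h0
        have hfib : ∑ X ∈ 𝒱, ((if V ⊆ X then (1 : K) else 0) +
            t * (if Disjoint V X then (1 : K) else 0)) * w X =
            ∑ C ∈ 𝒜', c C * ((if B \ A ⊆ C then (1 : K) else 0) +
              t * (if Disjoint (B \ A) C then (1 : K) else 0)) := by
          have hmaps : ∀ C ∈ 𝒜', C \ A ∈ 𝒱 := fun C hC => mem_image_of_mem _ hC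
          rw [← sum_fiberwise_of_maps_to hmaps]
          refine sum_congr rfl fun X _ => ?_
          rw [mul_sum]
          refine sum_congr rfl fun C hC => ?_
          obtain ⟨_, hCX⟩ := mem_filter.mp hC
          -- `[B \ A ⊆ C] = [B \ A ⊆ C \ A]`, `[(B \ A) ∩ C = ∅] = [(B \ A) ∩ (C \ A) = ∅]`
          have e1 : (B \ A ⊆ C) ↔ V ⊆ X := by
            rw [← hBV, ← hCX]
            constructor
            · intro h x hx
              exact mem_sdiff.mpr ⟨h hx, (mem_sdiff.mp hx).2⟩
            · intro h x hx
              exact (mem_sdiff.mp (h hx)).1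
          have e2 : Disjoint (B \ A) C ↔ Disjoint V X := by
            rw [← hBV, ← hCX, disjoint_left, disjoint_left]
            constructor
            · intro h x hx hx'
              exact h hx (mem_sdiff.mp hx').1
            · intro h x hx hxC
              exact h hx (mem_sdiff.mpr ⟨hxC, (mem_sdiff.mp hx).2⟩)
          rw [mul_comm]
          congr 2
          · exact if_congr e1.symm rfl rfl
          · congr 1
            exact if_congr e2.symm rfl rfl
        rw [hfib, h0]
      have hzero := hloc A hA w hw
      have hA' : A ∈ 𝒜' := mem_filter.mpr ⟨hA, le_rfl⟩
      have hempty : ∅ ∈ 𝒱 := mem_image.mpr ⟨A, hA', by simp⟩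
      have h := hzero ∅ hempty
      have e : 𝒜'.filter (fun C => C \ A = ∅) = {A} := by
        ext C
        simp only [mem_filter, mem_singleton, sdiff_eq_empty_iff_subset]
        constructor
        · rintro ⟨hC, hCA⟩
          obtain ⟨hC𝒜, hrC⟩ := mem_filter.mp hC
          by_contra hne
          exact hr C hC𝒜 A hA hne hrC hCA
        · rintro rfl
          exact ⟨hA', subset_rfl⟩
      change ∑ C ∈ 𝒜'.filter (fun C => C \ A = ∅), c C = 0 at h
      rwa [e, sum_singleton] at h

/-- **Determinant criterion.**  A local matrix (any entries `f W X`, indices a finite family `𝒲`) with non-zero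
determinant is injective in the sense used above. -/
theorem local_injective_of_det_ne_zero (𝒲 : Finset (Finset α)) (f : Finset α → Finset α → K)
    (hdet : (Matrix.of fun (W X : 𝒲) => f W X).det ≠ 0) (w : Finset α → K)
    (hw : ∀ W ∈ 𝒲, ∑ X ∈ 𝒲, f W X * w X = 0) : ∀ X ∈ 𝒲, w X = 0 := by
  classical
  intro X hX
  set v : ↥𝒲 → K := fun X => w X with hv
  have hmul : (Matrix.of fun (W X : 𝒲) => f W X).mulVec v = 0 := by
    funext W
    rw [Matrix.mulVec, Pi.zero_apply]
    change ∑ X : 𝒲, f W X * w X = 0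
    rw [Finset.sum_coe_sort 𝒲 (fun X => f W X * w X)]
    exact hw W W.2
  have h0 := Matrix.eq_zero_of_mulVec_eq_zero hdet hmul
  have := congr_fun h0 ⟨X, hX⟩
  simpa [hv] using this

/-- From a vanishing linear combination of the pencil rows to the pointwise dependency equations (local copy). -/
private theorem dep_of_sum_smul_eq_zero' (𝒜 : Finset (Finset α)) (t : K) (c : ↥𝒜 → K)
    (hc : ∑ A : 𝒜, c A • (fun E : (𝒜 \\ 𝒜 : Finset (Finset α)) =>
      (if (E : Finset α) ⊆ (A : Finset α) then (1 : K) else 0) +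
        t * (if Disjoint (E : Finset α) (A : Finset α) then (1 : K) else 0)) = 0) :
    ∀ E ∈ 𝒜 \\ 𝒜, ∑ C ∈ 𝒜, (fun C => if h : C ∈ 𝒜 then c ⟨C, h⟩ else 0) C *
      ((if E ⊆ C then (1 : K) else 0) + t * (if Disjoint E C then (1 : K) else 0)) = 0 := by
  classical
  intro E hE
  have h := congr_fun hc ⟨E, hE⟩
  simp only [Finset.sum_apply, Pi.smul_apply, smul_eq_mul, Pi.zero_apply] at h
  have h' : ∑ x ∈ 𝒜.attach, c x * ((if E ⊆ (x : Finset α) then (1 : K) else 0) +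
      t * (if Disjoint E (x : Finset α) then (1 : K) else 0)) = 0 := by
    rwa [← univ_eq_attach]
  rw [← sum_attach 𝒜]
  refine (sum_congr rfl fun A _ => ?_).trans h'
  have e : (fun C => if h : C ∈ 𝒜 then c ⟨C, h⟩ else 0) (A : Finset α) = c A := by
    simp only [dif_pos A.2]
  rw [e]

/-- **Independence from co-trace local matrices (front peeling).**  If `𝒜` has an admissible ranking `r`
(`r B ≤ r C`, `B ≠ C ⟹ B ⊄ C`) all of whose co-trace local matrices `[W ∩ X = ∅] + t [W ⊆ X]` on
`𝒲_A = {A \ C : r A ≤ r C}` are injective, then the pencil rows of `𝒜` over `𝒜 \\ 𝒜` are linearly independent at `t`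
(over any field). -/
theorem linearIndependent_pencil_of_cotraceLocal (𝒜 : Finset (Finset α)) (r : Finset α → ℕ)
    (hr : ∀ B ∈ 𝒜, ∀ C ∈ 𝒜, B ≠ C → r B ≤ r C → ¬ B ⊆ C) (t : K)
    (hloc : ∀ A ∈ 𝒜, ∀ w : Finset α → K,
      (∀ W ∈ (𝒜.filter (fun C => r A ≤ r C)).image (fun C => A \ C),
        ∑ X ∈ (𝒜.filter (fun C => r A ≤ r C)).image (fun C => A \ C),
          ((if Disjoint W X then (1 : K) else 0) + t * (if W ⊆ X then (1 : K) else 0)) * w X = 0) →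
      ∀ X ∈ (𝒜.filter (fun C => r A ≤ r C)).image (fun C => A \ C), w X = 0) :
    LinearIndependent K (fun A : 𝒜 => fun E : (𝒜 \\ 𝒜 : Finset (Finset α)) =>
      (if (E : Finset α) ⊆ (A : Finset α) then (1 : K) else 0) +
        t * (if Disjoint (E : Finset α) (A : Finset α) then (1 : K) else 0)) := by
  classical
  rw [Fintype.linearIndependent_iff]
  intro c hc A
  set c' : Finset α → K := fun C => if h : C ∈ 𝒜 then c ⟨C, h⟩ else 0 with hc'def
  have hc' : ∀ A : 𝒜, c' A = c A := fun A => by simp only [hc'def, dif_pos A.2]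
  have hdep := dep_of_sum_smul_eq_zero' 𝒜 t c hc
  have h := dep_eq_zero_of_cotraceLocal 𝒜 r hr (𝒜 \\ 𝒜)
    (fun B hB C hC _ => sdiff_mem_diffs hB hC) t c' hdep hloc A A.2
  rwa [hc' A] at h

/-- **Independence from trace local matrices (back peeling).**  If `𝒜` has a ranking `r` with `r C ≤ r B`, `B ≠ C ⟹
B ⊄ C` all of whose trace local matrices `[V ⊆ X] + t [V ∩ X = ∅]` on `𝒱_A = {B \ A : r A ≤ r B}` are injective, then
the pencil rows of `𝒜` over `𝒜 \\ 𝒜` are linearly independent at `t` (over any field). -/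
theorem linearIndependent_pencil_of_traceLocal (𝒜 : Finset (Finset α)) (r : Finset α → ℕ)
    (hr : ∀ B ∈ 𝒜, ∀ C ∈ 𝒜, B ≠ C → r C ≤ r B → ¬ B ⊆ C) (t : K)
    (hloc : ∀ A ∈ 𝒜, ∀ w : Finset α → K,
      (∀ V ∈ (𝒜.filter (fun B => r A ≤ r B)).image (fun B => B \ A),
        ∑ X ∈ (𝒜.filter (fun B => r A ≤ r B)).image (fun B => B \ A),
          ((if V ⊆ X then (1 : K) else 0) + t * (if Disjoint V X then (1 : K) else 0)) * w X = 0) →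
      ∀ X ∈ (𝒜.filter (fun B => r A ≤ r B)).image (fun B => B \ A), w X = 0) :
    LinearIndependent K (fun A : 𝒜 => fun E : (𝒜 \\ 𝒜 : Finset (Finset α)) =>
      (if (E : Finset α) ⊆ (A : Finset α) then (1 : K) else 0) +
        t * (if Disjoint (E : Finset α) (A : Finset α) then (1 : K) else 0)) := by
  classical
  rw [Fintype.linearIndependent_iff]
  intro c hc A
  set c' : Finset α → K := fun C => if h : C ∈ 𝒜 then c ⟨C, h⟩ else 0 with hc'def
  have hc' : ∀ A : 𝒜, c' A = c A := fun A => by simp only [hc'def, dif_pos A.2]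
  have hdep := dep_of_sum_smul_eq_zero' 𝒜 t c hc
  have h := dep_eq_zero_of_traceLocal 𝒜 r hr (𝒜 \\ 𝒜)
    (fun B hB C hC _ => sdiff_mem_diffs hB hC) t c' hdep hloc A A.2
  rwa [hc' A] at h

end OrderedDifferences

end Summit.CriticalPhenomena.PercolationContinuityZ3.Theorems
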